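import Mathlib
import HarnessLib
import Summits.HubbardSuperconductivity.HubbardSuperconductivity.Theorems.KLProgrammeKLRegimeSplitTwoLegSizesMSChainFramesF
import Summits.HubbardSuperconductivity.HubbardSuperconductivity.Theorems.KLProgrammeKLRegimeSplitTwoLegSizesMSOfChain

/-!
# Route `KLProgramme`, crux K3 — gen-5 ENGINE child (stmt-…-19918, `stub_twoLeg_step`, clause `TwoLegSizesMST`), recipe (L)+(F):
# (E3a-MS) AT SCALE `n+1` FROM THE CHAIN-FAMILY PROFILES' ANGULAR SIZES (`msProfileF` version of `…MSOfChain`)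

Seat hubbard-kl-k3c3-p1 (g3).  Same structural reduction as `twoLegSizesMST_succ_of_chain_sizes`, with the increment symbol a FAMILY
`S : ℕ → TrigPolyC4v` riding the chain (k3c3-p2's fix (a)): the increment profile is read through the symbol at the LAST chain frame,
`klLocalPart (n+1) − klLocalPart n = (S (nScales β − (n+1))) ∘ k_F^K`, and the witness profiles are `msProfileF`.  Proofs only.
-/

noncomputable section

namespace Summit.HubbardSuperconductivity.HubbardSuperconductivity.Theorems.KLRegimeSplit

set_option linter.dupNamespace false -- summit = problem name (single-conjunct summit), D-0017

open Real Finset Literature.MathematicalPhysics.QuantumLattice Literature.MathematicalPhysics.QuantumLattice.FermiRG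
open Summit.HubbardSuperconductivity.HubbardSuperconductivity.Theorems.KLProgrammeLegKernels

/-- **The chain-family profiles are `C⁴`** when every chain frame has a `C⁴` Fermi curve. -/
theorem contDiff_msProfileF (μ : ℝ) (S : ℕ → TrigPolyC4v) (d : ℕ) (Kp : ℕ → TrigPolyC4v) (n N : ℕ)
    (hC : ∀ k ≤ N - n, ContDiff ℝ 4 (klFermiPoint μ (msChain d Kp n N k))) (m : ℕ) :
    ContDiff ℝ 4 (msProfileF μ S d Kp n N m) := by
  by_cases hm : m = n
  · subst hm
    rw [msProfileF_base]; exact contDiff_curveProfile μ (S 0) _ (hC 0 (Nat.zero_le _))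
  · by_cases hm' : m ∈ Ioc n N
    · have hmn : n < m ∧ m ≤ N := Finset.mem_Ioc.mp hm'
      have h : msProfileF μ S d Kp n N m = fun θ =>
          curveProfile μ (S (m - n)) (msChain d Kp n N (m - n)) θ -
            curveProfile μ (S (m - n - 1)) (msChain d Kp n N (m - n - 1)) θ := by
        funext θ; simp [msProfileF, hm, hm']
      rw [h]
      exact (contDiff_curveProfile μ _ _ (hC (m - n) (by omega))).sub (contDiff_curveProfile μ _ _ (hC (m - n - 1) (by omega)))
    · rw [msProfileF_of_not_mem hm hm']; exact contDiff_const

section MS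

variable {L M : ℕ} [NeZero L] [NeZero M] {G : GeoConsts} {Q : EngConsts} {R : RenConsts} {β U μ : ℝ}

/-- **(E3a-MS) AT SCALE `n+1` FROM THE CHAIN-FAMILY PROFILES' ANGULAR SIZES.**  See the module docstring. -/
theorem twoLegSizesMST_succ_of_chainF_sizes (hμ : μ ∈ klWindowC) {K : TrigPolyC4v} {Kp : ℕ → TrigPolyC4v}
    (hK : ∀ p : Fin 2 → ℝ, K.eval p = ∑ m ∈ range (nScales β + 1), (Kp m).eval p) {n : ℕ} (hn : n + 1 ≤ nScales β) (d : ℕ)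
    (hc₁ : Continuous (klLocalPart L M β U μ K (n + 1))) (hc₀ : Continuous (klLocalPart L M β U μ K n))
    {S : ℕ → TrigPolyC4v}
    (hS : ∀ θ, klLocalPart L M β U μ K (n + 1) θ - klLocalPart L M β U μ K n θ =
      (S (nScales β - (n + 1))).eval (klFermiPoint μ K θ))
    (hC : ∀ k ≤ nScales β - (n + 1), ContDiff ℝ 4 (klFermiPoint μ (msChain d Kp (n + 1) (nScales β) k)))
    {X : ℝ} (hX : ∀ l ≤ 4, ∀ x : ℝ, ‖iteratedFDeriv ℝ l salmhoferCutoff x‖ ≤ X)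
    (Gs : ℕ → ℕ → ℝ)
    (hGs : ∀ m, ∀ j ≤ 4, ∀ i ≤ j, ∀ t : ℝ,
      ‖iteratedFDeriv ℝ i (fun t => msProfileF μ S d Kp (n + 1) (nScales β) m t -
        klAngularMean (msProfileF μ S d Kp (n + 1) (nScales β) m)) t‖ ≤ Gs m j)
    (hfit_n : ∀ j ≤ 4, (if j = 0 then |klAngularMean (msProfileF μ S d Kp (n + 1) (nScales β) (n + 1))| else 0) +
      (j.factorial : ℝ) ^ 2 * (2 * j.factorial * X * 200 ^ j) * Gs (n + 1) j * (4 + max 1 (((j - 1).factorial : ℝ) / (8 / 5))) ^ j ≤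
        twoLegBar G Q U j (n + 1))
    (hfit_m : ∀ m ∈ Ioc (n + 1) (nScales β), ∀ j ≤ 4,
      (if j = 0 then |klAngularMean (msProfileF μ S d Kp (n + 1) (nScales β) m)| else 0) +
      (j.factorial : ℝ) ^ 2 * (2 * j.factorial * X * 200 ^ j) * Gs m j * (4 + max 1 (((j - 1).factorial : ℝ) / (8 / 5))) ^ j ≤
        msBar G Q U (n + 1) * (R.Gfr j * uPow j U * (4 : ℝ) ^ (((j : ℤ) - 2) * m))) :
    TwoLegSizesMST L M G Q R β U μ K (n + 1) := by
  have hδ : (fun θ => klLocalPart L M β U μ K (n + 1) θ - klLocalPart L M β U μ K n θ) =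
      curveProfile μ (S (nScales β - (n + 1))) K := by
    funext θ; rw [hS θ]; rfl
  have hP : klTwoLegPieceFn L M β U μ K.eval (n + 1) = klFrameExtFn μ (curveProfile μ (S (nScales β - (n + 1))) K) := by
    rw [klTwoLegPieceFn_eval_succ β U μ K n hc₁ hc₀, hδ]
  exact twoLegSizesMST_of_profile_split hμ hP (msProfileF μ S d Kp (n + 1) (nScales β))
    (fun θ => msProfileF_split μ S d hK hn θ) (contDiff_msProfileF μ S d Kp (n + 1) (nScales β) hC)
    (msProfileF_periodic μ S d Kp (n + 1) (nScales β)) (msProfileF_even μ S d Kp (n + 1) (nScales β))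
    (msProfileF_diag μ S d Kp (n + 1) (nScales β)) hX Gs hGs hfit_n hfit_m

end MS

end Summit.HubbardSuperconductivity.HubbardSuperconductivity.Theorems.KLRegimeSplit

end
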